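import Summits.Ventures.PackingBounds.Configurations.Dim10Card24
import Summits.Ventures.PackingBounds.ThreePointCert.G27Proof

/-!
# `24 ≤ A(10, arccos 1/10) ≤ 26` in Lean: both sides of the T5 cell `(10, 1/10)` in one statement

Framing: lottery ticket; floor = certified bounds/negative ranges. Venture `PackingBounds` (cell
`pub-packcert`, seat `pub-packcert-recog`).  The lower bound is the Hardin–Smith–Sloane `24`-point code
(`Config.Dim10Card24.exists_code_24`, an explicit configuration over `ℤ[√3]` checked by `decide`); the upper
bound is the kernel theorem `ThreePointCert.G27.code_dim10_tenth_le_26` (exact Bachoc–Vallentin three-point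
value `27` + complementary slackness + integrality).  No new mathematics in this file: it only conjoins the
two theorems so that the cell's two-sided status `24 ≤ A(10, arccos 1/10) ≤ 26` is one citable declaration.
The remaining gap (`25` or `26` points?) is open.

## References
* N. J. A. Sloane et al., *Tables of Spherical Codes*, `dim10/wds.10.24.txt`. [`HardinSloaneSmithSphericalCodes`]
* C. Bachoc, F. Vallentin, J. Amer. Math. Soc. 21 (2008), Theorem 4.2. [`BachocVallentin2007`]
-/

namespace Summit.Ventures.PackingBounds.SphericalCodes.TenTenthBounds

open Summit.Ventures.PackingBounds

/-- **`24 ≤ A(10, arccos 1/10) ≤ 26` (kernel-checked).**  There is a set of `24` unit vectors of `ℝ¹⁰` with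
pairwise inner products `≤ 1/10` (the Hardin–Smith–Sloane code), and every finite set of unit vectors of
`ℝ¹⁰` with pairwise inner products `≤ 1/10` has at most `26` elements.
[cite: HardinSloaneSmithSphericalCodes, Part 2 dim10/wds.10.24.txt] [cite: BachocVallentin2007, Theorem 4.2] -/
theorem code_dim10_tenth_between_24_26 :
    (∃ C : Finset (EuclideanSpace ℝ (Fin 10)), C.card = 24 ∧ (∀ x ∈ C, ‖x‖ = 1) ∧
        ∀ x ∈ C, ∀ y ∈ C, x ≠ y → inner ℝ x y ≤ 1 / 10) ∧
      ∀ C : Finset (EuclideanSpace ℝ (Fin 10)), (∀ x ∈ C, ‖x‖ = 1) →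
        (∀ x ∈ C, ∀ y ∈ C, x ≠ y → inner ℝ x y ≤ 1 / 10) → C.card ≤ 26 :=
  ⟨Config.Dim10Card24.exists_code_24, ThreePointCert.G27.code_dim10_tenth_le_26⟩

end Summit.Ventures.PackingBounds.SphericalCodes.TenTenthBounds
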